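import Summits.QuantumFields.YangMills.Theorems.UnitScaleTiltProp7KerQprimePoincareNE9
import Summits.QuantumFields.YangMills.Theorems.UnitScaleTiltProp7QprimeCombL2Defs
import Summits.QuantumFields.YangMills.Theorems.UnitScaleTiltProp7CombTranslateDefs
import Summits.QuantumFields.YangMills.Theorems.UnitScaleTiltProp7LandauDictT3
import Summits.QuantumFields.YangMills.Theorems.UnitScaleTiltProp7RieszTauFrobNormT3
import Summits.QuantumFields.YangMills.Theorems.UnitScaleTiltProp7AxialReprPrint
import Literature.MathematicalPhysics.QuantumFieldTheory.Balaban1983to89.B7AvgClosedSpecialUnitarySharp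
import Literature.MathematicalPhysics.QuantumFieldTheory.Balaban1983to89.T3PrintedMinimiserExistence
import HarnessLib

/-!
# Route `UnitScaleTilt`, crux K1 «MinimiserStabilityRegPr» (stmt-QuantumFields-19200) — LANE II «DIVERGENCE RECOVERY AT CURVED `W`» (★★OWNER RULING №23), brick (B5),
# FILE 2∕2 (the member): **`blockPoincare_kerQprime` — BLOCK POINCARÉ ON `ker QprimeCombL2 W` AT EVERY `W ∈ RegPr F n K e`**, the text of ★p1 g19's SKELETON v1.2∕v1.3 §3 (B5)
# TOKEN FOR TOKEN, discharged as a DICTIONARY onto the pub-balaban NE9 chain's [Balaban1985BackgroundPropagators] Thm 3.11 site clause (FILE 1 ✓`Prop7KerQprimePoincareNE9`)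

Cell `ym3-torus` ∕ width seat `ym-ust-19200-w1` (gen 15).  THEOREMS ONLY (0 `def`, 0 `sorry`); `--supports stmt-QuantumFields-19200 --as helper`, count-neutral.
YM₃ on T³ is a ladder rung (R3), not d = 4, not infinite volume, not the Clay problem; nothing here claims the stub, the crux, `hN06`, (V3) or the mass gap.

THE ROW (skeleton (B5), shape `∀ L ∃ CP CP′ ∀ F n K e W λ`): on `RegPr F n K e W`, for every gauge parameter `λ` with `QprimeCombL2 F n K (c₀ L) W λ = 0`,
`‖λ‖² ≤ CP·‖DL2 F n K (c₀ L) W λ‖² + CP′·e²·‖λ‖²`.  HOW: for `e ≤ eP(L)` (`eP := min(A₁∕4, 1∕(6C₀(3)), c₂′(3,L)∕4)`, `A₁` the absolute threshold of FILE 1's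
✓`exists_normSq_le_of_ker_QprimeTowerW` at `φ := frobEquiv`, `τ := trace`, `M_φ = 1`, `M_φ′ = 2`) the NE9 theorem applies to the TRANSLATED member data
`W′ := W ∘ τ_c`, `λ′ := tauS c λ`, `c := halfBlockVec F n K` (the half-block offset of RULING №18: `QprimeCombL2` reads `λ` and `W` pulled back at `basePt F n K`): its periods are
`periodsT3 F K = towerP L (N_{K−n}) (K−n)` (✓`sitesPerDir_zero_eq`), its plaquette class (52) is ✓`pdev_pull_lt ∘ inAk_pull_of_regPr` at `x₀ := basePt`, its values lie in the
averaging-closed `SU(2)` (✓`avgClosed_specialUnitary_of_le_twentyone`), its kernel hypothesis is ✓`QprimeCombL2_eq_zero_iff` read through FILE 1 §2, and the two norms are translation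
invariant (`tauS`, `tauB` of ✓`Prop7CombTranslate`; `DL2 W′ (tauS c λ) = tauB c (DL2 W λ)` below); on print's diagonal `η·L^{K−n} = 1` the conclusion is `‖λ‖² ≤ CP·‖DL2 W λ‖²`.
For `e > eP` the row holds trivially with `CP′ := eP⁻²` (`CP′e² ≥ 1`).  So `CP` is ABSOLUTE and `CP′` reads `L` only (through `c₂′(3, L)`), as the (R1) shape allows.

WHAT IS PROVED (ns `…Theorems.Prop7BlockPoincareKerQprime`):
§1 dictionary rows — `periodsT3_eq_towerP`, `siteEquiv_symm_perSite` (`e⁻¹(z mod N) = 0 + z`), `transl_siteEquiv_symm_perSite_halfBlockVec` (`… + c = basePt + z`),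
`adBg_eq_adTransportW`, `bgUnits_translate`, `perCfg_bgOfCfg_translate_eq_pull` (the periodic extension of the translated background IS the route's pull at `basePt`),
`DL2_translate_tauS` (`DL2 W′ (tauS c λ) = tauB c (DL2 W λ)`), `read_tauS_perSite` (the reading of `tauS c λ` at `z mod N` is `λ♯(basePt + z)`);
§2 ★★★ `blockPoincare_kerQprime` — the (B5) text of record.
HONEST SCOPE.  Bookkeeping over FILE 1 and landed letters; the analysis is lit NE9's (Thm 3.11 site clause at the class (52)); nothing of (REC) ∕ `hN06` ∕ the crux proved.
Rung R3 (YM₃ on T³), not Clay; YM gap NOT proved.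

References: T. Bałaban, CMP **99** (1985) 389–434 [Balaban1985BackgroundPropagators] ((3.19) p.393, (3.24) p.394, (3.35) p.396, Thm 3.11 p.416); CMP **98** (1985) 17–51
[Balaban1985Averaging] ((52) p.26); CMP **89** (1983) 571–597 [Balaban1983RegularityDecay] ((2.27) p.580); CMP **99** (1985) 75–102 [Balaban1985RegularSpaces] ((1.7) p.77).
-/

set_option autoImplicit false

noncomputable section

open scoped BigOperators InnerProductSpace ComplexConjugate Matrix.Norms.L2Operator

namespace Summit.QuantumFields.YangMills.Theorems.Prop7BlockPoincareKerQprime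

open Literature.MathematicalPhysics.QuantumFieldTheory.Balaban1983to89
open Literature.MathematicalPhysics.QuantumFieldTheory.Balaban1983to89.T3ContinuumYM3Torus
open Literature.MathematicalPhysics.QuantumFieldTheory.Balaban1983to89.T3PrintedRegularMinimiser (RegPr)
open B4Sect5Torus (TSite)
open B9SectCLatticeCarrier (Bond)
open B7Prop1Explicit (U1)
open B7Prop2Explicit (pdev C0 c2' AvgClosed C0_pos c2'_pos)
open B7Eq78Linearization (QprimeIter zdBlocking)
open B8Eq119TwistedAxial (bgT)
open B9Eq311L2Pairing (WL2)
open B11Eq103H1Complex (SiteL2K BondL2K covDerivL2K)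
open B9Eq310HessianOperator (adTransportW adTransportW_apply)
open B9Eq315QTorus (perSite perCfg perCfg_apply)
open B9Eq315QTower (towerP towerP_apply)
open B9Eq326OperatorTower (QprimeTowerW)
open B10Eq27TorusAxialLog (transl pull transl_apply pull_apply transl_add)
open T3SectALandauChart (bgUnits eta eta_pos covDerivFwdT)
open B7AvgClosedSpecialUnitarySharp (avgClosed_specialUnitary_of_le_twentyone)
open B7Prop2SpecialUnitary (specialUnitaryUnits)
open B8Thm2SetupTorus (unitsField_toUField_mem)
open Summit.QuantumFields.YangMills.Theorems.Prop7SectET3Transport (periodsT3 siteEquiv bondEquiv bgOfCfg siteEquiv_symm_apply bgOfCfg_eq isUnitaryBg_bgOfCfg)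
open Summit.QuantumFields.YangMills.Theorems.Prop7SectET3HilbertLetters (W₂ frobEquiv adW adBg toL2 toL2S DL2 toL2S_apply toL2S_symm_apply frobEquiv_adW inner_frobEquiv_symm)
open Summit.QuantumFields.YangMills.Theorems.Prop7SPrint (basePt)
open Summit.QuantumFields.YangMills.Theorems.Prop7QprimeCombL2 (QprimeCombL2 QprimeCombL2_eq_zero_iff sitesPerDir_zero_eq)
open Summit.QuantumFields.YangMills.Theorems.Prop7CombTranslate (siteTransl bondTransl siteTranslEquiv bondTranslEquiv siteTransl_apply bondTransl_apply tauS tauB tauS_toL2S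
  tauB_toL2 halfBlockVec halfBlockVec_apply transl_shift)
open Summit.QuantumFields.YangMills.Theorems.Prop7LandauDict (DL2_toL2S_eq_covDerivFwdT)
open Summit.QuantumFields.YangMills.Theorems.Prop7RieszTauFrobNorm (norm_frobEquiv_le norm_frobEquiv_symm_le)
open Summit.QuantumFields.YangMills.Theorems.Prop7AxialReprPrint (pdev_pull_lt inAk_pull_of_regPr)
open Summit.QuantumFields.YangMills.Theorems.Prop7KerQprimePoincareNE9 (exists_normSq_le_of_ker_QprimeTowerW QprimeTowerW_eq_zero_of_forall_QprimeIter_eq_zero)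

/-! ## §1 Dictionary rows -/

section Dictionary

variable (F : T3Family) (n K : ℕ)

/-- **THE MEMBER's PERIODS ARE A TOWER**: `periodsT3 F K = towerP L (N_{K−n}) (K − n)` (`N₀ = L^{K−n}·N_{K−n}`, ✓`sitesPerDir_zero_eq`), written with `K − n = (K − n − 1) + 1`.
[cite: Balaban1985RegularSpaces, p.77; Balaban1985Averaging, (1)–(2) p.17] -/
theorem periodsT3_eq_towerP (hnK : n < K) :
    periodsT3 F K = towerP F.L (fun _ : Fin 3 => (F.P K).sitesPerDir (K - n)) (K - n - 1 + 1) := by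
  funext i
  rw [towerP_apply, Nat.sub_add_cancel (by omega)]
  exact sitesPerDir_zero_eq F n K hnK.le

variable {F K}

/-- `ZMod.finEquiv n k = (k : ℕ)` cast into `ZMod n` (for `n = n′ + 1` the equivalence is the identity of `Fin n`). [folklore] -/
theorem zmodFinEquiv_eq_natCast_val {N : ℕ} [NeZero N] (k : Fin N) : ZMod.finEquiv N k = ((k : ℕ) : ZMod N) := by
  cases N with
  | zero => exact absurd rfl (NeZero.ne 0)
  | succ N => exact (Fin.cast_val_eq_self k).symm

/-- **THE [B9] TORUS SITE OF AN INTEGER POINT, READ IN THE ROUTE's CHART**: `e⁻¹(z mod N) = 0 + z` (`transl 0 z`). [cite: Balaban1987RG1, (0.1) p.251] -/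
theorem siteEquiv_symm_perSite (z : B7Prop1Explicit.Site 3) : (siteEquiv F K).symm (perSite (periodsT3 F K) z) = transl (0 : Site (F.P K) 0) z := by
  funext ν
  rw [siteEquiv_symm_apply, transl_apply, show (0 : Site (F.P K) 0) ν = 0 from rfl, zero_add]
  have hN : (0 : ℤ) < ((F.P K).sitesPerDir 0 : ℤ) := by exact_mod_cast Nat.pos_of_ne_zero (NeZero.ne _)
  have h2 : (((perSite (periodsT3 F K) z ν : Fin ((F.P K).sitesPerDir 0)) : ℕ) : ZMod ((F.P K).sitesPerDir 0)) = ((z ν : ℤ) : ZMod ((F.P K).sitesPerDir 0)) := by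
    have hv : ((perSite (periodsT3 F K) z ν : Fin ((F.P K).sitesPerDir 0)) : ℕ) = (z ν % ((F.P K).sitesPerDir 0 : ℤ)).toNat := rfl
    rw [hv, ← Int.cast_natCast, Int.toNat_of_nonneg (Int.emod_nonneg _ hN.ne'), ZMod.intCast_mod]
  rw [zmodFinEquiv_eq_natCast_val, h2]

/-- **THE HALF-BLOCK OFFSET**: `(0 + z) + c = basePt + z` for `c = halfBlockVec F n K` (the integer labels of `basePt F n K`). [cite: Balaban1987RG1, (0.1) p.251; Balaban1985Averaging, (85)–(87) p.31] -/
theorem transl_siteEquiv_symm_perSite_halfBlockVec (z : B7Prop1Explicit.Site 3) :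
    transl ((siteEquiv F K).symm (perSite (periodsT3 F K) z)) (halfBlockVec F n K) = transl (basePt F n K) z := by
  rw [siteEquiv_symm_perSite]
  funext ν
  rw [transl_apply, transl_apply, transl_apply, show (0 : Site (F.P K) 0) ν = 0 from rfl, zero_add, halfBlockVec_apply, Int.cast_natCast,
    ZMod.natCast_zmod_val, add_comm]

variable (F K)

/-- **THE ROUTE's TRANSPORTER IS NE9's**: `adBg F K W = adTransportW frobEquiv (bgOfCfg F K W)` (both are `w ↦ frobEquiv⁻¹(U·frobEquiv w·U⁻¹)`). [cite: Balaban1985BackgroundPropagators, (3.3) p.391] -/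
theorem adBg_eq_adTransportW (W : GaugeField (F.P K) 0 (Matrix.specialUnitaryGroup (Fin 2) ℂ)) :
    adBg F K W = adTransportW frobEquiv (bgOfCfg F K W) := by
  funext b
  apply LinearMap.ext
  intro w
  apply frobEquiv.injective
  rw [adBg, frobEquiv_adW, adTransportW_apply, LinearEquiv.apply_symm_apply]

/-- `DL2 F n K c₀ W` IS NE9's `covDerivL2K ℂ c₀ η⁻¹ (adTransportW frobEquiv (bgOfCfg F K W))`. [cite: Balaban1985BackgroundPropagators, (3.3) p.391] -/
theorem DL2_eq_covDerivL2K (c₀ : ℝ) [Fact (0 < c₀)] (W : GaugeField (F.P K) 0 (Matrix.specialUnitaryGroup (Fin 2) ℂ)) :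
    DL2 F n K c₀ W = covDerivL2K ℂ c₀ (((eta F n K : ℝ) : ℂ)⁻¹) (adTransportW frobEquiv (bgOfCfg F K W)) := by
  rw [DL2, adBg_eq_adTransportW]

/-- The unit-valued bond variables of the translated configuration `W ∘ τ_c` are those of `W` at the translated bond. [cite: Balaban1985Averaging, (19) p.21] -/
theorem bgUnits_translate (c : B7Prop1Explicit.Site 3) (W : GaugeField (F.P K) 0 (Matrix.specialUnitaryGroup (Fin 2) ℂ)) (b : PBond (F.P K) 0) :
    bgUnits F K (fun b => W (bondTranslEquiv F K c b)) b = bgUnits F K W (bondTranslEquiv F K c b) := rfl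

/-- ★ **THE PERIODIC EXTENSION OF THE HALF-BLOCK-TRANSLATED BACKGROUND IS THE ROUTE's PULL AT `basePt`**:
`perCfg (periodsT3 F K) (bgOfCfg F K (W ∘ τ_c)) = pull (bgUnits F K W) (basePt F n K)`, `c = halfBlockVec F n K`. [cite: Balaban1985Averaging, (9) p.18, (19) p.21; Balaban1985RegularSpaces, (1.3) p.77] -/
theorem perCfg_bgOfCfg_translate_eq_pull (W : GaugeField (F.P K) 0 (Matrix.specialUnitaryGroup (Fin 2) ℂ)) :
    perCfg (periodsT3 F K) (bgOfCfg F K (fun b => W (bondTranslEquiv F K (halfBlockVec F n K) b))) = pull (bgUnits F K W) (basePt F n K) := by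
  funext z κ
  rw [perCfg_apply, bgOfCfg_eq, pull_apply]
  show bgUnits F K (fun b => W (bondTranslEquiv F K (halfBlockVec F n K) b)) ⟨(siteEquiv F K).symm (perSite (periodsT3 F K) z), κ⟩ = _
  rw [bgUnits_translate]
  show bgUnits F K W ⟨transl ((siteEquiv F K).symm (perSite (periodsT3 F K) z)) (halfBlockVec F n K), κ⟩ = _
  rw [transl_siteEquiv_symm_perSite_halfBlockVec]

/-- ★ **THE COVARIANT DERIVATIVE COMMUTES WITH THE LATTICE TRANSLATIONS**: `DL2 (W ∘ τ_c) (tauS c λ) = tauB c (DL2 W λ)` (every background `W`; at `W = 1` this is px13's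
✓`DL2_one_tauS`). [cite: Balaban1985BackgroundPropagators, (3.3) p.391, (3.11) p.392] -/
theorem DL2_translate_tauS (c₀ : ℝ) [Fact (0 < c₀)] (c : B7Prop1Explicit.Site 3) (W : GaugeField (F.P K) 0 (Matrix.specialUnitaryGroup (Fin 2) ℂ))
    (l : SiteL2K ℂ 3 (periodsT3 F K) c₀ W₂) :
    DL2 F n K c₀ (fun b => W (bondTranslEquiv F K c b)) (tauS F K c₀ c l) = tauB F K c₀ c (DL2 F n K c₀ W l) := by
  obtain ⟨f, rfl⟩ : ∃ f, l = toL2S F K c₀ f := ⟨(toL2S F K c₀).symm l, ((toL2S F K c₀).apply_symm_apply l).symm⟩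
  rw [tauS_toL2S]
  obtain ⟨A, hA⟩ : ∃ A, DL2 F n K c₀ W (toL2S F K c₀ f) = toL2 F K c₀ A := ⟨(toL2 F K c₀).symm _, ((toL2 F K c₀).apply_symm_apply _).symm⟩
  rw [hA, tauB_toL2]
  apply (toL2 F K c₀).symm.injective
  rw [LinearEquiv.symm_apply_apply]
  funext b
  rw [DL2_toL2S_eq_covDerivFwdT, bondTransl_apply]
  have hb : A (bondTranslEquiv F K c b) = (toL2 F K c₀).symm (DL2 F n K c₀ W (toL2S F K c₀ f)) (bondTranslEquiv F K c b) := by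
    rw [hA, LinearEquiv.symm_apply_apply]
  rw [hb, DL2_toL2S_eq_covDerivFwdT]
  show covDerivFwdT (eta F n K) (bgUnits F K fun b => W (bondTranslEquiv F K c b)) b.dir (siteTransl F K c f) b.src
    = covDerivFwdT (eta F n K) (bgUnits F K W) b.dir f (transl b.src c)
  simp only [covDerivFwdT, siteTransl_apply, transl_shift]
  rfl

/-- ★ **THE READING OF THE TRANSLATED PARAMETER AT AN INTEGER POINT**: `frobEquiv((tauS c λ)(z mod N)) = λ♯(basePt + z)` — the function FILE 1's `ℤ³` reading sees IS the one
✓`QprimeCombL2_eq_zero_iff` speaks about. [cite: Balaban1985BackgroundPropagators, (3.19) p.393; Balaban1985RegularSpaces, (1.29) p.81] -/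
theorem read_tauS_perSite (c₀ : ℝ) [Fact (0 < c₀)] (l : SiteL2K ℂ 3 (periodsT3 F K) c₀ W₂) (z : B7Prop1Explicit.Site 3) :
    frobEquiv ((WL2.linearEquiv ℂ ℂ (fun _ : TSite 3 (periodsT3 F K) => c₀)) (tauS F K c₀ (halfBlockVec F n K) l) (perSite (periodsT3 F K) z))
      = (toL2S F K c₀).symm l (transl (basePt F n K) z) := by
  obtain ⟨f, rfl⟩ : ∃ f, l = toL2S F K c₀ f := ⟨(toL2S F K c₀).symm l, ((toL2S F K c₀).apply_symm_apply l).symm⟩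
  rw [tauS_toL2S, WL2.linearEquiv_apply, toL2S_apply, LinearEquiv.apply_symm_apply, siteTransl_apply, transl_siteEquiv_symm_perSite_halfBlockVec,
    LinearEquiv.symm_apply_apply]

end Dictionary

/-! ## §2 The row (B5) of record -/

section Row

variable (c₀ cB : ℕ → ℝ) [hc₀ : ∀ L : ℕ, Fact (0 < c₀ L)] [hcB : ∀ L : ℕ, Fact (0 < cB L)]

/-- ★★★ (B5) **BLOCK POINCARÉ ON `N(Q′_W) = ker QprimeCombL2 W`** — ★p1 g19 SKELETON v1.2∕v1.3 §3 TEXT TOKEN FOR TOKEN: `∀ L ∃ CP CP′ ∀ F n K e W λ`: on `RegPr F n K e W`, for every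
gauge parameter `λ` with `QprimeCombL2 W λ = 0`, `‖λ‖² ≤ CP·‖DL2 W λ‖² + CP′·e²·‖λ‖²`.  `CP` = NE9's `γ⁻¹` (ABSOLUTE: [Balaban1985BackgroundPropagators] Thm 3.11's site clause at
the class (52), FILE 1 ✓`exists_normSq_le_of_ker_QprimeTowerW`, applied to the half-block-translated member data on print's diagonal `ηL^{K−n} = 1`);
`CP′ = eP(L)⁻²` only covers the complement `e > eP` of the printed-regular window (there `CP′e² ≥ 1`).
[cite: Balaban1983RegularityDecay, (2.27) p.580; Balaban1985BackgroundPropagators, (3.19)-(3.21) pp.393-394, Thm 3.11 p.416; Balaban1985Averaging, (52) p.26] -/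
theorem blockPoincare_kerQprime : ∀ (L : ℕ), 1 < L → ∃ CP CP' : ℝ, 0 ≤ CP ∧ 0 ≤ CP' ∧
    ∀ (F : T3Family), F.L = L → ∀ (n K : ℕ) (hnK : n < K) (e : ℝ), 0 ≤ e → ∀ (W : GaugeField (F.P K) 0 (Matrix.specialUnitaryGroup (Fin 2) ℂ)), RegPr F n K e W →
      ∀ l : SiteL2K ℂ 3 (periodsT3 F K) (c₀ F.L) W₂, QprimeCombL2 F n K (c₀ F.L) W l = 0 →
        ‖l‖ ^ 2 ≤ CP * ‖DL2 F n K (c₀ F.L) W l‖ ^ 2 + CP' * e ^ 2 * ‖l‖ ^ 2 := by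
  intro L hL
  -- the fibre letters of record: `φ := frobEquiv` (`M_φ = 1`, `M_φ′ = 2`), `τ := trace`
  have hτφ : ∀ X Y : Matrix (Fin 2) (Fin 2) ℂ, ⟪frobEquiv.symm X, frobEquiv.symm Y⟫_ℂ = Matrix.traceLinearMap (Fin 2) ℂ ℂ (star X * Y) := fun X Y => by
    rw [inner_frobEquiv_symm, Matrix.traceLinearMap_apply, Matrix.star_eq_conjTranspose]
  have htr : ∀ X Y : Matrix (Fin 2) (Fin 2) ℂ, Matrix.traceLinearMap (Fin 2) ℂ ℂ (X * Y) = Matrix.traceLinearMap (Fin 2) ℂ ℂ (Y * X) := fun X Y => by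
    rw [Matrix.traceLinearMap_apply, Matrix.traceLinearMap_apply, Matrix.trace_mul_comm]
  have hφ : ∀ w : W₂, ‖frobEquiv w‖ ≤ 1 * ‖w‖ := fun w => by rw [one_mul]; exact norm_frobEquiv_le w
  have hφ' : ∀ X : Matrix (Fin 2) (Fin 2) ℂ, ‖frobEquiv.symm X‖ ≤ 2 * ‖X‖ := fun X =>
    (norm_frobEquiv_symm_le X).trans (mul_le_mul_of_nonneg_right (by
      have h := Real.sqrt_le_sqrt (show (2 : ℝ) ≤ 4 by norm_num)
      rwa [show (4 : ℝ) = 2 ^ 2 by norm_num, Real.sqrt_sq (by norm_num : (0:ℝ) ≤ 2)] at h) (norm_nonneg _))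
  obtain ⟨A₁, CP, hA₁, hCP, hNE9⟩ := exists_normSq_le_of_ker_QprimeTowerW (d := 3) frobEquiv (Matrix.traceLinearMap (Fin 2) ℂ ℂ)
    zero_le_one zero_le_two hφ hφ' hτφ htr
  -- the window: `α₀ := 2eP` inside print's (52) windows and NE9's `A₁`
  have hC0 := C0_pos 3
  have hc2 := c2'_pos 3 L (by omega)
  obtain ⟨eP, heP⟩ : ∃ eP : ℝ, eP = min (A₁ / 4) (min (1 / (6 * C0 3)) (c2' 3 L / 4)) := ⟨_, rfl⟩
  have hePpos : 0 < eP := by rw [heP]; exact lt_min (by positivity) (lt_min (by positivity) (by positivity))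
  have heA : 1 * 2 * (2 * eP) ≤ A₁ := by
    have : eP ≤ A₁ / 4 := by rw [heP]; exact min_le_left _ _
    linarith
  have he3 : C0 3 * (2 * eP) ≤ 1 / 3 := by
    have h : eP ≤ 1 / (6 * C0 3) := by rw [heP]; exact (min_le_right _ _).trans (min_le_left _ _)
    have h' : C0 3 * eP ≤ C0 3 * (1 / (6 * C0 3)) := mul_le_mul_of_nonneg_left h hC0.le
    have h'' : C0 3 * (1 / (6 * C0 3)) = 1 / 6 := by field_simp
    linarith
  have he2 : 2 * (2 * eP) ≤ c2' 3 L := by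
    have : eP ≤ c2' 3 L / 4 := by rw [heP]; exact (min_le_right _ _).trans (min_le_right _ _)
    linarith
  refine ⟨CP, (eP⁻¹) ^ 2, hCP.le, by positivity, ?_⟩
  intro F hF n K hnK e he W hreg l hl
  have hD0 : 0 ≤ CP * ‖DL2 F n K (c₀ F.L) W l‖ ^ 2 := by positivity
  by_cases hle : e ≤ eP
  swap
  · -- outside the printed-regular window the slack term alone dominates
    have hlt : eP < e := not_le.mp hle
    have h1 : 1 ≤ (eP⁻¹) ^ 2 * e ^ 2 := by
      rw [← mul_pow, ← one_pow 2]
      exact pow_le_pow_left₀ zero_le_one (by rw [le_inv_mul_iff₀' hePpos]; linarith) 2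
    nlinarith [norm_nonneg l, sq_nonneg ‖l‖]
  -- inside the window: NE9's theorem on the half-block-translated member data
  subst hF
  have hL2 : 2 ≤ F.L := by omega
  haveI : NeZero F.L := ⟨by omega⟩
  set c : B7Prop1Explicit.Site 3 := halfBlockVec F n K with hc
  set W' : GaugeField (F.P K) 0 (Matrix.specialUnitaryGroup (Fin 2) ℂ) := fun b => W (bondTranslEquiv F K c b) with hW'
  set U' : Bond 3 (periodsT3 F K) → (Matrix (Fin 2) (Fin 2) ℂ)ˣ := bgOfCfg F K W' with hU'
  set l' : SiteL2K ℂ 3 (periodsT3 F K) (c₀ F.L) W₂ := tauS F K (c₀ F.L) c l with hl'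
  -- (52) for the periodic extension = the route's pull at `basePt`
  have hperCfg : perCfg (periodsT3 F K) U' = pull (bgUnits F K W) (basePt F n K) := by
    rw [hU', hW', hc]; exact perCfg_bgOfCfg_translate_eq_pull F n K W
  have hreg' : RegPr F n K eP W := T3PrintedMinimiserExistence.regPr_mono F hle hreg
  have h52₀ : pdev (pull (bgUnits F K W) (basePt F n K)) < 2 * eP * ((((F.P K).L : ℝ) ^ (K - n))⁻¹) ^ 2 :=
    pdev_pull_lt hePpos (inAk_pull_of_regPr F hePpos.le hreg') (basePt F n K)
  have h52 : pdev (perCfg (periodsT3 F K) U') < 2 * eP * (((F.L : ℝ) ^ (K - n))⁻¹) ^ 2 := by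
    rw [hperCfg]; exact h52₀
  -- the member's periods as a tower, and NE9's theorem generalised over the period function
  have hP := periodsT3_eq_towerP F n K hnK
  have key : ∀ (P : Fin 3 → ℕ) [∀ i, NeZero (P i)] (hP : P = towerP F.L (fun _ : Fin 3 => (F.P K).sitesPerDir (K - n)) (K - n - 1 + 1))
      (U : Bond 3 P → (Matrix (Fin 2) (Fin 2) ℂ)ˣ), (∀ b, U b ∈ specialUnitaryUnits (Fin 2)) → (∀ b, star (U b : Matrix (Fin 2) (Fin 2) ℂ) = (((U b)⁻¹ : (Matrix (Fin 2) (Fin 2) ℂ)ˣ) : Matrix (Fin 2) (Fin 2) ℂ)) →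
      pdev (perCfg P U) < 2 * eP * ((((F.L : ℕ) : ℝ) ^ (K - n - 1 + 1))⁻¹) ^ 2 →
      ∀ (lam : SiteL2K ℂ 3 P (c₀ F.L) W₂),
        (∀ z : B7Prop1Explicit.Site 3, QprimeIter (zdBlocking 3 F.L) (bgT F.L (perCfg P U)) (K - n - 1 + 1)
          (fun z => frobEquiv ((WL2.linearEquiv ℂ ℂ (fun _ : TSite 3 P => c₀ F.L)) lam (perSite P z))) z = 0) →
        ‖lam‖ ^ 2 ≤ CP * (eta F n K * ((F.L : ℕ) : ℝ) ^ (K - n - 1 + 1)) ^ 2 *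
          ‖covDerivL2K ℂ (c₀ F.L) (((eta F n K : ℝ) : ℂ)⁻¹) (adTransportW frobEquiv U) lam‖ ^ 2 := by
    intro P _ hP U hU hUstar h52' lam hker
    subst hP
    have hm : ∀ i : Fin 3, 2 ≤ (fun _ : Fin 3 => (F.P K).sitesPerDir (K - n)) i := fun i => by
      show 2 ≤ 2 * (F.P K).L ^ ((F.P K).m + (F.P K).K - (K - n))
      exact Nat.le_mul_of_pos_right _ (pow_pos (by show 0 < F.L; omega) _)
    have hηN : 0 < eta F n K * ((F.L : ℕ) : ℝ) ^ (K - n - 1 + 1) := mul_pos (eta_pos F n K) (by positivity)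
    exact hNE9 F.L hL2 (specialUnitaryUnits (Fin 2)) (avgClosed_specialUnitary_of_le_twentyone (N := 2) (by norm_num) 3 F.L) (K - n - 1)
      (fun _ : Fin 3 => (F.P K).sitesPerDir (K - n)) hm U hU hUstar (2 * eP) (by positivity) he3 he2 h52' heA (eta F n K) hηN (c₀ F.L) lam
      (QprimeTowerW_eq_zero_of_forall_QprimeIter_eq_zero frobEquiv F.L _ (K - n - 1) U lam hker)
  -- feed the member data
  have hU'mem : ∀ b, U' b ∈ specialUnitaryUnits (Fin 2) := fun b => by
    rw [hU', bgOfCfg_eq]; exact unitsField_toUField_mem W' _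
  have hU'star : ∀ b, star (U' b : Matrix (Fin 2) (Fin 2) ℂ) = (((U' b)⁻¹ : (Matrix (Fin 2) (Fin 2) ℂ)ˣ) : Matrix (Fin 2) (Fin 2) ℂ) :=
    fun b => (isUnitaryBg_bgOfCfg F K W' b).symm
  have hKn : K - n - 1 + 1 = K - n := by omega
  have h52'' : pdev (perCfg (periodsT3 F K) U') < 2 * eP * ((((F.L : ℕ) : ℝ) ^ (K - n - 1 + 1))⁻¹) ^ 2 := by rw [hKn]; exact h52
  have hker : ∀ z : B7Prop1Explicit.Site 3, QprimeIter (zdBlocking 3 F.L) (bgT F.L (perCfg (periodsT3 F K) U')) (K - n - 1 + 1)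
      (fun z => frobEquiv ((WL2.linearEquiv ℂ ℂ (fun _ : TSite 3 (periodsT3 F K) => c₀ F.L)) l' (perSite (periodsT3 F K) z))) z = 0 := by
    intro z
    have hfun : (fun z => frobEquiv ((WL2.linearEquiv ℂ ℂ (fun _ : TSite 3 (periodsT3 F K) => c₀ F.L)) l' (perSite (periodsT3 F K) z)))
        = fun z => (toL2S F K (c₀ F.L)).symm l (transl (basePt F n K) z) := by
      funext z; rw [hl', hc]; exact read_tauS_perSite F n K (c₀ F.L) l z
    rw [hfun, hperCfg, hKn]
    exact (QprimeCombL2_eq_zero_iff hnK.le W l).1 hl z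
  have hmain := key (periodsT3 F K) hP U' hU'mem hU'star h52'' l' hker
  -- read the two norms back: `‖l′‖ = ‖l‖`, `‖D_{U′}l′‖ = ‖DL2 W l‖`, `ηL^{K−n} = 1`
  have hnl : ‖l'‖ = ‖l‖ := by rw [hl']; exact (tauS F K (c₀ F.L) c).norm_map l
  have hnD : ‖covDerivL2K ℂ (c₀ F.L) (((eta F n K : ℝ) : ℂ)⁻¹) (adTransportW frobEquiv U') l'‖ = ‖DL2 F n K (c₀ F.L) W l‖ := by
    rw [hU', ← DL2_eq_covDerivL2K, hl', hW', DL2_translate_tauS, LinearIsometryEquiv.norm_map]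
  have hηL : eta F n K * ((F.L : ℕ) : ℝ) ^ (K - n - 1 + 1) = 1 := by
    rw [hKn, eta, ← mul_pow, inv_mul_cancel₀ (by exact_mod_cast (show F.L ≠ 0 by omega)), one_pow]
  rw [hnl, hnD, hηL, one_pow, mul_one] at hmain
  have hslack : 0 ≤ (eP⁻¹) ^ 2 * e ^ 2 * ‖l‖ ^ 2 := by positivity
  linarith

end Row

end Summit.QuantumFields.YangMills.Theorems.Prop7BlockPoincareKerQprime

end
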